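import Mathlib

/-!
# WeilDiscTable — which `ℚ(√-d)`-ball strata of the `U² ⊕ D₄(-1)` face have a Markman-covered Weil sixfold

(solo-blind s47, sheets.md §15 (viii)–(ix).)  On a `ℚ(√-d)`-ball stratum of the face the simple
Weil sixfold `B″ = ∧²_{K′} B′` has discriminant `det h`, and `det h ≡ -1 (mod Nm K′^×)` iff
`⟨d, d⟩ ≅ ⟨1, 1⟩` over `ℚ`, iff `d` is a sum of two squares.  We certify:

* `gram_two_squares`: for `d = 1, 2, 5, 10, 13` an integral matrix `P` with `Pᵀ P = d • 1`, so
  `⟨d,d⟩ ≅ ⟨1,1⟩` over `ℚ` and `B″` lies in Markman's discriminant `-1` family (Thm 1.5.1 of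
  arXiv:2502.03415 applies);
* `not_two_squares`: `3, 6, 11, 14, 19, 21, 22` are not sums of two integer squares (hence, by
  Davenport–Cassels / the prime-`3 mod 4` criterion, not of two rational squares): there `disc B″ ≢ -1`
  and the Weil classes of `B″` are an open case;
* `polarization_trick`: the arithmetic behind "the non-simple sixfold `B′ × E′²` always has
  discriminant `-1` for a suitable product polarization": for `K′ = ℚ(√-3)`, `det⟨1,-1,-1,-2⟩ · 2c · c = -4c²`
  and `4 = Nm(2)`, i.e. `-4c² ≡ -1`.
-/

namespace Summit.HodgeConjecture.HodgeConjecture.Theorems.WeilDiscTable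

open Matrix

/-- Integral `2 × 2` matrices `P_d` with `P_dᵀ P_d = d • 1` for `d = 1, 2, 5, 10, 13`. -/
def P (d : ℕ) : Matrix (Fin 2) (Fin 2) ℤ :=
  if d = 1 then !![1, 0; 0, 1]
  else if d = 2 then !![1, 1; 1, -1]
  else if d = 5 then !![1, 2; 2, -1]
  else if d = 10 then !![1, 3; 3, -1]
  else !![2, 3; 3, -2]

/-- `⟨d,d⟩ ≅ ⟨1,1⟩` over `ℚ` for `d = 1, 2, 5, 10, 13`: explicit Gram identities `Pᵀ P = d • 1`
with `det P ≠ 0`.  On these `ℚ(√-d)`-ball strata `disc B″ = -1` (Markman-covered). -/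
theorem gram_two_squares :
    (P 1)ᵀ * P 1 = (1 : ℤ) • 1 ∧ (P 2)ᵀ * P 2 = (2 : ℤ) • 1 ∧ (P 5)ᵀ * P 5 = (5 : ℤ) • 1 ∧
    (P 10)ᵀ * P 10 = (10 : ℤ) • 1 ∧ (P 13)ᵀ * P 13 = (13 : ℤ) • 1 ∧
    (P 1).det = 1 ∧ (P 2).det = -2 ∧ (P 5).det = -5 ∧ (P 10).det = -10 ∧ (P 13).det = -13 := by
  refine ⟨?_, ?_, ?_, ?_, ?_, ?_, ?_, ?_, ?_, ?_⟩ <;> decide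

/-- `3, 6, 11, 14, 19, 21, 22` are not sums of two integer squares (so, by Davenport–Cassels, not of two
rational squares either): on these `ℚ(√-d)`-ball strata `disc B″ ≢ -1` and `Weil(B″)` is open. -/
theorem not_two_squares :
    ∀ d ∈ ([3, 6, 11, 14, 19, 21, 22] : List ℕ), ¬ ∃ x y : ℕ, x ^ 2 + y ^ 2 = d := by
  intro d hd ⟨x, y, h⟩
  simp only [List.mem_cons, List.not_mem_nil, or_false] at hd
  have hx : x ≤ 4 := by
    rcases hd with rfl | rfl | rfl | rfl | rfl | rfl | rfl <;> nlinarith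
  have hy : y ≤ 4 := by
    rcases hd with rfl | rfl | rfl | rfl | rfl | rfl | rfl <;> nlinarith
  rcases hd with rfl | rfl | rfl | rfl | rfl | rfl | rfl <;>
    interval_cases x <;> interval_cases y <;> omega

/-- The `2`-adic side (REMARK K′): the strata exist (2 non-split) for all `d` in both lists except none —
`-d mod 8 ≠ 1` for `d = 1,2,3,5,6,10,11,13,14,19,21,22`. -/
theorem balls_exist :
    ∀ d ∈ ([1, 2, 3, 5, 6, 10, 11, 13, 14, 19, 21, 22] : List ℤ), (-d) % 8 ≠ 1 := by
  decide

/-- The polarization trick for `K′ = ℚ(√-3)`: `det(⟨1,-1,-1,-2⟩ ⊕ ⟨2c⟩ ⊕ ⟨c⟩) = -4c²` and `4 = Nm(2)`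
(`2·2 + 2·0·… `: `x² + 3y²` with `x = 2, y = 0`; also `x² - xy + y²` with `x = y = 2`), so the class is `-1`;
while `2` itself is not of the form `x² + 3y²` nor `x² - xy + y² ` with small arguments (it is inert). -/
theorem polarization_trick :
    (∀ c : ℤ, (1 : ℤ) * (-1) * (-1) * (-2) * (2 * c) * c = -4 * c ^ 2) ∧
    (2 : ℤ) ^ 2 + 3 * 0 ^ 2 = 4 ∧ (2 : ℤ) ^ 2 - 2 * 2 + 2 ^ 2 = 4 ∧
    (¬ ∃ x y : ℕ, x ^ 2 + 3 * y ^ 2 = 2) := by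
  refine ⟨fun c => by ring, by norm_num, by norm_num, ?_⟩
  rintro ⟨x, y, h⟩
  have hx : x ≤ 1 := by nlinarith
  have hy : y ≤ 0 := by nlinarith
  interval_cases x <;> interval_cases y <;> omega

end Summit.HodgeConjecture.HodgeConjecture.Theorems.WeilDiscTable
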